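import Mathlib
import Summits.CriticalPhenomena.CardyFormulaZ2.Theorems.CardyMagicRigidityNestingRigidityUVExpMomentsDilation
import Summits.CriticalPhenomena.CardyFormulaZ2.Theorems.CardyMagicRigidityNestingRigidityTowerMomentUpper
import Summits.CriticalPhenomena.CardyFormulaZ2.Theorems.CardyMagicRigidityNestingRigidityConeTiltLoopSide
import Summits.CriticalPhenomena.CardyFormulaZ2.Theorems.CardyMagicRigidityMagicFormulaTStubDilation
import HarnessLib

/-!
# Crux `NestingRigidity`: keystone K5 — uniform-in-mesh exponential moments of the nested-loop count
# of a FIXED annulus, both lattices (from [B-up] by exact dilation covariance)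

Crux `Summit.CriticalPhenomena.CardyFormulaZ2.Theses.CardyMagicRigidity.NestingRigidity`
(stmt-CriticalPhenomena-4835), lines `ring-cloud-tomography` (r6) and `positive-cone-weight-doubling` (r4).
Registered keystone K5 `towerCount_expMoment_bound` (registered by the ring-cloud lead c3-0 for its
staircase input (QU): gap towers of the staircase are nested-loop counts `towerCount 0 a b` of FIXED
annuli `A(a, b)`): for `E ∈ latticeEnsembles`, every base `u ≥ 1` and `0 < a < b` there is `B` with
`E_δ[u ^ towerCount (X_δ) 0 a b] ≤ B` for all small meshes.  This file proves it, sorry-free, as a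
COROLLARY of the landed a-priori bound [B-up] `towerMoment_upper_latticeEnsembles` (p129280:
`E_δ[w ^ towerCount (X_δ) 0 r 1] ≤ r ^ (-C)`) and the exact DILATION COVARIANCE of both lattice loop
ensembles (`loops_mul_latticeEnsembles`, …UVExpMomentsDilation p130117; winding numbers and traces of
dilated loops, `wind_imageOn_mul` / `setOf_wind_imageOn_mul_ne_zero`, …MagicFormulaTStubDilation):
* §1 `towerCount_mul_latticeEnsembles` — pathwise `towerCount (X_{cδ} ω) 0 (cρ) (cR) = towerCount (X_δ ω) 0 ρ R`
  (`c > 0`), and monotonicity of the count in the inner radius;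
* §2 the anchor: shrink the inner disc to `b·ρ`, `ρ = min (a/b) (r₀/2)`, rescale the window `b` to `1`
  (mesh `δ/b`), and read [B-up] at radius `ρ < r₀`: `B = ρ ^ (-C)`.
No cited fact, no definition.
-/

noncomputable section

open MeasureTheory Set Filter Metric
open scoped Real Topology BigOperators Pointwise

namespace Summit.CriticalPhenomena.CardyFormulaZ2.Cruxes.NestingRigidity.PositiveConeWeightDoubling

open Literature.Probability.RandomPlanarGeometry Literature.Probability.Percolation
  Literature.Probability.LatticeModels
open Summit.CriticalPhenomena.CardyFormulaZ2.Cruxes.NestingRigidity.RingCloudTomography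
open Summit.CriticalPhenomena.CardyFormulaZ2.Cruxes.MagicFormulaT.LineSketch
  (wind_imageOn_mul imageOn_mul_injective setOf_wind_imageOn_mul_ne_zero)

namespace TowerCountExp

/-! ## §1 Tower counts under dilation; monotonicity in the inner radius -/

/-- The tower predicate is dilation covariant: the `c`-dilate of `u` surrounds `B̄(0, cρ)` inside
`B(0, cR)` iff `u` surrounds `B̄(0, ρ)` inside `B(0, R)` (`c > 0`). -/
theorem tower_pred_imageOn_mul_iff {c : ℝ} (hc : 0 < c) (ρ R : ℝ) (u : UnbasedLoop ℂ) :
    (closedBall (0 : ℂ) (c * ρ) ⊆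
        {z | (UnbasedLoop.imageOn (fun z ↦ (c : ℂ) * z) univ u).wind z ≠ 0} ∧
      (UnbasedLoop.imageOn (fun z ↦ (c : ℂ) * z) univ u).range ⊆ ball (0 : ℂ) (c * R)) ↔
    (closedBall (0 : ℂ) ρ ⊆ {z | u.wind z ≠ 0} ∧ u.range ⊆ ball (0 : ℂ) R) := by
  have hc0 : (c : ℂ) ≠ 0 := Complex.ofReal_ne_zero.2 hc.ne'
  have hnorm : ‖(c : ℂ)‖ = c := by rw [Complex.norm_real, Real.norm_of_nonneg hc.le]
  have hball : ball (0 : ℂ) (c * R) = (c : ℂ) • ball (0 : ℂ) R := by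
    rw [_root_.smul_ball hc0, smul_zero, hnorm]
  have hcball : closedBall (0 : ℂ) (c * ρ) = (c : ℂ) • closedBall (0 : ℂ) ρ := by
    rcases le_or_gt 0 ρ with hρ | hρ
    · rw [_root_.smul_closedBall _ _ hρ, smul_zero, hnorm]
    · rw [closedBall_eq_empty.2 (by nlinarith), closedBall_eq_empty.2 hρ, Set.smul_set_empty]
  have hwind : {z | (UnbasedLoop.imageOn (fun z ↦ (c : ℂ) * z) univ u).wind z ≠ 0} =
      (c : ℂ) • {z : ℂ | u.wind z ≠ 0} := by
    rw [setOf_wind_imageOn_mul_ne_zero hc u]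
    ext z
    simp only [Set.mem_smul_set, Complex.real_smul, smul_eq_mul]
  rw [hwind, hcball, hball, UVExpMoments.range_imageOn_mul,
    Set.smul_set_subset_smul_set_iff₀ hc0, Set.smul_set_subset_smul_set_iff₀ hc0]

/-- **Pathwise dilation covariance of the tower count** on both lattice ensembles:
`towerCount (X_{cδ} ω) 0 (cρ) (cR) = towerCount (X_δ ω) 0 ρ R` for `c > 0`. -/
theorem towerCount_mul_latticeEnsembles : ∀ E ∈ latticeEnsembles, ∀ {c : ℝ}, 0 < c →
    ∀ (δ ρ R : ℝ) (ω : E.Ω),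
      towerCount (E.X (c * δ) ω) 0 (c * ρ) (c * R) = towerCount (E.X δ ω) 0 ρ R := by
  intro E hE c hc δ ρ R ω
  unfold towerCount
  rw [loops_mul_latticeEnsembles E hE c δ ω]
  have hset : {u ∈ UnbasedLoop.imageOn (fun z ↦ (c : ℂ) * z) univ '' (E.X δ ω).loops |
      closedBall (0 : ℂ) (c * ρ) ⊆ {z | u.wind z ≠ 0} ∧ u.range ⊆ ball (0 : ℂ) (c * R)} =
      UnbasedLoop.imageOn (fun z ↦ (c : ℂ) * z) univ ''
        {u ∈ (E.X δ ω).loops | closedBall (0 : ℂ) ρ ⊆ {z | u.wind z ≠ 0} ∧ u.range ⊆ ball (0 : ℂ) R} := by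
    ext v
    simp only [mem_setOf_eq, mem_image]
    constructor
    · rintro ⟨⟨u, hu, rfl⟩, hv⟩
      exact ⟨u, ⟨hu, (tower_pred_imageOn_mul_iff hc ρ R u).1 hv⟩, rfl⟩
    · rintro ⟨u, ⟨hu, hq⟩, rfl⟩
      exact ⟨⟨u, hu, rfl⟩, (tower_pred_imageOn_mul_iff hc ρ R u).2 hq⟩
  rw [hset, Set.ncard_image_of_injective _ (imageOn_mul_injective hc.ne')]

/-- The tower count is antitone in the inner radius (lattice configurations: the counted sets are
finite): shrinking the inner disc can only add loops. -/
theorem towerCount_anti_latticeEnsembles : ∀ E ∈ latticeEnsembles, ∀ {δ : ℝ}, 0 < δ →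
    ∀ (ω : E.Ω) {ρ ρ' R : ℝ}, ρ' ≤ ρ →
      towerCount (E.X δ ω) 0 ρ R ≤ towerCount (E.X δ ω) 0 ρ' R := by
  intro E hE δ hδ ω ρ ρ' R hρ
  unfold towerCount
  refine Set.ncard_le_ncard (fun u hu ↦ ⟨hu.1, (closedBall_subset_closedBall hρ).trans hu.2.1, hu.2.2⟩)
    ((ConeTilt.finite_loops_meeting E hE hδ ω R).subset fun u hu ↦ ⟨hu.1, ?_⟩)
  obtain ⟨z, hz⟩ := u.range_nonempty
  exact ⟨z, hz, mem_closedBall.2 (le_of_lt (mem_ball.1 (hu.2.2 hz)))⟩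

end TowerCountExp

/-- **Keystone K5 · uniform exponential moments of the nested-loop count of a fixed annulus, both
lattices** (registered `towerCount_expMoment_bound`): for `E ∈ latticeEnsembles`, `u ≥ 1` and `0 < a < b`
there is `B` with `u ^ towerCount (X_δ) 0 a b` integrable and `E_δ[u ^ towerCount (X_δ) 0 a b] ≤ B` for
all small meshes.  From [B-up] (`towerMoment_upper_latticeEnsembles`, p129280) by dilating the window
`b` to `1` (`TowerCountExp.towerCount_mul_latticeEnsembles`) and shrinking the inner radius below the
threshold `r₀` of [B-up] (`TowerCountExp.towerCount_anti_latticeEnsembles`). -/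
theorem towerCount_expMoment_bound : ∀ E ∈ latticeEnsembles, ∀ (u a b : ℝ), 1 ≤ u → 0 < a → a < b →
    ∃ B : ℝ, ∀ᶠ δ in 𝓝[>] (0 : ℝ), Integrable (fun ω ↦ u ^ towerCount (E.X δ ω) 0 a b) E.P ∧
      ∫ ω, u ^ towerCount (E.X δ ω) 0 a b ∂E.P ≤ B := by
  intro E hE u a b hu ha hab
  have hb : 0 < b := ha.trans hab
  have hu0 : 0 < u := one_pos.trans_le hu
  obtain ⟨C, r₀, hr₀, hup⟩ := towerMoment_upper_latticeEnsembles E hE u hu0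
  set ρ : ℝ := min (a / b) (r₀ / 2) with hρdef
  have hρ0 : 0 < ρ := lt_min (div_pos ha hb) (half_pos hr₀)
  have hρr₀ : ρ < r₀ := (min_le_right _ _).trans_lt (half_lt_self hr₀)
  have hρa : b * ρ ≤ a := by
    have h : ρ ≤ a / b := min_le_left _ _
    rwa [le_div_iff₀ hb, mul_comm] at h
  refine ⟨ρ ^ (-C), ?_⟩
  -- [B-up] along the rescaled meshes `δ / b`
  have hdiv : Tendsto (fun δ : ℝ ↦ δ / b) (𝓝[>] (0 : ℝ)) (𝓝[>] (0 : ℝ)) := by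
    refine tendsto_nhdsWithin_of_tendsto_nhds_of_eventually_within _ ?_ ?_
    · have h : Tendsto (fun δ : ℝ ↦ δ / b) (𝓝 (0 : ℝ)) (𝓝 (0 / b)) := tendsto_id.div_const b
      rw [zero_div] at h
      exact h.mono_left nhdsWithin_le_nhds
    · filter_upwards [self_mem_nhdsWithin] with δ hδ using div_pos hδ hb
  filter_upwards [hdiv.eventually (hup ρ ⟨hρ0, hρr₀⟩), self_mem_nhdsWithin] with δ hδup hδ
  rw [Set.mem_Ioi] at hδ
  refine ⟨ConeTilt.integrable_pow_towerCount_of_nonneg E hE u hδ 0 a b hu0.le, ?_⟩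
  -- shrink the inner disc, then rescale the window `b` to `1`
  have hmono : ∀ ω, u ^ towerCount (E.X δ ω) 0 a b ≤ u ^ towerCount (E.X δ ω) 0 (b * ρ) b := fun ω ↦
    pow_le_pow_right₀ hu (TowerCountExp.towerCount_anti_latticeEnsembles E hE hδ ω hρa)
  have hscale : ∀ ω, towerCount (E.X δ ω) 0 (b * ρ) b = towerCount (E.X (δ / b) ω) 0 ρ 1 := fun ω ↦ by
    have hX : E.X δ ω = E.X (b * (δ / b)) ω := by rw [mul_div_cancel₀ _ hb.ne']
    rw [hX, ← TowerCountExp.towerCount_mul_latticeEnsembles E hE hb (δ / b) ρ 1 ω, mul_one]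
  calc ∫ ω, u ^ towerCount (E.X δ ω) 0 a b ∂E.P
      ≤ ∫ ω, u ^ towerCount (E.X δ ω) 0 (b * ρ) b ∂E.P :=
        integral_mono (ConeTilt.integrable_pow_towerCount_of_nonneg E hE u hδ 0 a b hu0.le)
          (ConeTilt.integrable_pow_towerCount_of_nonneg E hE u hδ 0 (b * ρ) b hu0.le) hmono
    _ = E.towerMoment u (δ / b) ρ := by
        simp only [LoopEnsemble.towerMoment, hscale]
    _ ≤ ρ ^ (-C) := hδup

end Summit.CriticalPhenomena.CardyFormulaZ2.Cruxes.NestingRigidity.PositiveConeWeightDoubling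

end
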